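import Summits.ResolutionOfSingularities.ResolutionOfSingularities.Theorems.MarkedTransferCampaignW46MohWindowShadeAnchorWalk
import Summits.ResolutionOfSingularities.ResolutionOfSingularities.Theorems.MarkedTransferCampaignW46MohWindowShadeAnchorOrder
import Summits.ResolutionOfSingularities.ResolutionOfSingularities.Theorems.MarkedTransferCampaignW46MohWindowShadePolyStatement
import HarnessLib

/-!
# [OURS · L1 W4.6 rung (iii)] The polynomial purely inseparable surface window regime PROPAGATES along permissible blow-ups
# (algebraically closed base field): `Regime.mohWindowSurfacePoly` at a stage and o1's regime of record at the next stage give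
# `Regime.mohWindowSurfacePoly` at the next stage

Cell `res-hironaka`, LADDER-RESOLUTION rung L (D-0089), slot W4.6 rung (iii); seat res-L1-s46-pv-6 (gen 4). Host route MarkedTransfer,
`--supports stmt-ResolutionOfSingularities-16155 --as helper`; kind proof (no definition).

WHY. `…MohWindowShadePolyStatement.lean` (p520644, OURS-desk #215) imposes the polynomial presentation `MohWindowSurfacePolyAt` at EVERY
stage (regimes have no memory). This file shows the extra conjunct is NOT an extra constraint on runs: **`mohWindowSurfacePoly_transform`**
— over an algebraically closed field, if `(Z, E)` is in `Regime.mohWindowSurfacePoly`, `π : Z′ → Z` is the blow-up at a permissible centre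
(a single closed point) and the transform `(Z′, E′)` is in o1's regime of record `regimeMohWindowSurfaceInsep`, then `(Z′, E′)` is in
`Regime.mohWindowSurfacePoly`. So a permissible sequence inside the regime of record whose initial stage has polynomial presentations
stays inside the polynomial regime (`permissibleRun_mohWindowSurfacePoly_of_start`), and the sub-regime rung `MohWindowSurfacePolyPermissiblyTerminates`
is the stage-0 statement `…PolyTerminates.false_of_permissibleRun_insep_polyStart` in regime clothing. MECHANISM: this seat's ENTRANCE DOOR —
over the centre the anchor upstairs is `PointBlowup.step` (`…AnchorStep.exists_anchor_step`), CLEANED by construction, and its order is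
`> p` by the bottom-edge brick `…AnchorOrder.ordZero_ne_of_mohWindowSurfaceAt` (the regime upstairs asks for a window exponent `> p`) and
`< 2p` by `…AnchorWalk.window_of_anchor`; off the centre the anchor is transported verbatim (`…AnchorChart.exists_anchor_offCentre`).

HONEST FRAMING. Nothing here is a statement of H. Hironaka's manuscript [Hironaka2017] (2017-03-23 — scope only, under adjudication) and
nothing asserts that any statement of it holds. AI-written; AI review is weaker than expert review. No `sorry`; axioms standard. [folklore]
-/

noncomputable section

set_option linter.dupNamespace false -- mandated namespace of this single-conjunct summit

open CategoryTheory AlgebraicGeometry TopologicalSpace IsLocalRing MvPolynomial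

namespace Summit.ResolutionOfSingularities.ResolutionOfSingularities.Theorems

namespace CampaignW46

namespace MohWindowShadePolyPersistence

open Literature.AlgebraicGeometry.Resolution
open Literature.AlgebraicGeometry.Resolution.PointBlowup
open Literature.AlgebraicGeometry.Resolution.Hauser2010
open Literature.AlgebraicGeometry.Hironaka2017.S02Preliminaries
open Literature.AlgebraicGeometry.Hironaka2017.Datum
open Scheme.IdealSheafData

universe u

variable {p : ℕ} [Fact p.Prime] {K : Type u} [Field K] [CharP K p]

omit [Fact p.Prime] [CharP K p] in
/-- The output of the model step is cleaned (cleaning is idempotent). [cite: Hauser2010, §G (cleaning of p-th power monomials)] -/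
theorem deletePthPowers_step_F [DecidableEq K] {σ : Type} [Fintype σ] [DecidableEq σ] (c : σ) (b : σ → K) (s : State σ K) :
    deletePthPowers p (step p c b s).F = (step p c b s).F := by
  classical
  show deletePthPowers p (deletePthPowers p (pointTransform p c b s)) = deletePthPowers p (pointTransform p c b s)
  refine MohWindowShadeCleaning.deletePthPowers_eq_self_of_forall p fun d hd hP => ?_
  rw [MvPolynomial.mem_support_iff, coeff_deletePthPowers, if_pos hP] at hd
  exact hd rfl

/-- **PERSISTENCE.** [OURS · L1 W4.6 rung (iii)] NOT a statement of the manuscript. Over an algebraically closed field: if `(Z, E)` lies in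
`Regime.mohWindowSurfacePoly`, `π : Z′ → Z` is a blow-up of the ambient datum at a permissible centre and the transform lies in o1's
regime `regimeMohWindowSurfaceInsep`, then the transform lies in `Regime.mohWindowSurfacePoly`. [cite: Hauser2010, §F (chart expressions of a point blowup)] -/
theorem mohWindowSurfacePoly_transform [IsAlgClosed K] {A A' : AmbientDatum p K} {E : IdealExponent A.Z} {D : Closeds A.Z}
    (π : A'.Z ⟶ A.Z) (hπ : IsBlowup π (vanishingIdeal D)) (hhom : A'.hom = π ≫ A.hom) (hD : E.IsPermissibleCentre A.hom D)
    (hRg : Regime.mohWindowSurfacePoly (p := p) (K := K) A E)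
    (hRg' : regimeMohWindowSurfaceInsep (p := p) (K := K) A' (E.transform π D)) :
    Regime.mohWindowSurfacePoly (p := p) (K := K) A' (E.transform π D) := by
  classical
  haveI : IsLocallyNoetherian A'.Z := by
    haveI := A'.smooth
    exact LocallyOfFiniteType.isLocallyNoetherian A'.hom
  refine ⟨hRg', fun ξ' hξ' => ?_⟩
  obtain ⟨hRgI, hpoly⟩ := hRg
  obtain ⟨ξ₀, hξ₀S, hξ₀cl, hDξ₀⟩ :=
    IsPermissibleCentre.exists_eq_singleton_of_isolatedSing hD ((regimeMohWindowSurfaceInsep_iff _ _).mp hRgI).1.1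
  obtain ⟨hR', h3', hcl', hwin', hb'⟩ := MohWindowShadeAnchorWalk.regime_point hRg' hξ'
  haveI := hR'
  haveI : CharP (A'.Z.presheaf.stalk ξ') p :=
    Literature.AlgebraicGeometry.Hironaka2017.S16Proof.Lem16p11Proof.charP_stalk A π ξ'
  have hb : E.b = p := ((regimeMohWindowSurfaceInsep_iff _ _).mp hRgI).2
  have hbE' : (E.transform π D).b = p := hb
  have hκκ' : ∀ l, (π.stalkMap ξ').hom (germConst A (π.base ξ') l) = germConst A' ξ' l :=
    fun l => MohWindowShadeAnchorWalk.stalkMap_germ_sectionConst π hhom ξ' l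
  have hrat' : ∀ r : A'.Z.presheaf.stalk ξ', ∃ l : K, r - germConst A' ξ' l ∈ maximalIdeal _ :=
    fun r => MohWindowShadeAnchorWalk.exists_sub_germ_sectionConst_mem A' hcl' r
  have hsingle : stalkIdeal (E.transform π D).J ξ' ≤ maximalIdeal _ ^ p := by
    have := (le_idealOrder_iff (E.transform π D).J ξ' (E.transform π D).b).mp hξ'
    rwa [hbE'] at this
  -- the anchor downstairs, at `π ξ'` (a singular point of `E`)
  have hmem : π.base ξ' ∈ E.sing := sing_subset_of_transform hπ E hD.subset_sing hξ'
  obtain ⟨hR, h3, x, y, z, hxyz, F, hclean, hpF, hF2, hI⟩ := hpoly (π.base ξ') hmem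
  haveI := hR
  rw [vec2_eq_frame] at hI
  -- conclusion template
  have conclude : ∀ (F' : MvPolynomial (Fin 2) K) (x' y' z' : A'.Z.presheaf.stalk ξ'),
      deletePthPowers p F' = F' → Ideal.span {x', y', z'} = maximalIdeal _ →
      stalkIdeal (E.transform π D).J ξ' =
        Ideal.span {z' ^ p + eval₂ (germConst A' ξ') (fun l => if l = (0 : Fin 2) then x' else y') F'} →
      MohWindowSurfacePolyAt p (germConst A' ξ') (stalkIdeal (E.transform π D).J ξ') := by
    intro F' x' y' z' hclean' hspan' hJ'
    have hw := MohWindowShadeAnchorWalk.window_of_anchor hRg' hξ' hspan' _ F' hJ'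
    have hwin'' : MohWindowSurfaceAt p (A'.Z.presheaf.stalk ξ')
        (Ideal.span {z' ^ p + eval₂ (germConst A' ξ') (fun l => if l = (0 : Fin 2) then x' else y') F'}) := by
      have h := hwin'
      rwa [hJ'] at h
    have hne := MohWindowShadeAnchorOrder.ordZero_ne_of_mohWindowSurfaceAt hR' h3' hspan' (germConst A' ξ') hrat'
      (j := (0 : Fin 2)) (i := 1) (by decide) (fun l => by fin_cases l <;> simp) hclean' hwin''
    refine ⟨hR', h3', x', y', z', hspan', F', hclean', lt_of_le_of_ne hw.1 (fun h => hne h.symm), hw.2, ?_⟩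
    rw [hJ', vec2_eq_frame]
  by_cases hover : π.base ξ' = ξ₀
  · -- over the centre: the model takes a step
    have hDπ : (D : Set A.Z) = {π.base ξ'} := by rw [hDξ₀, hover]
    have hclπ : IsClosed ({π.base ξ'} : Set A.Z) := by rw [hover]; exact hξ₀cl
    have hdeg : ∀ d ∈ F.support, p ≤ d.degree := fun d hd =>
      (Literature.Barriers.ResolutionOfSingularities.HauserPerlega.natCast_le_ordZero_iff F p).mp hpF.le d hd
    obtain ⟨c, b, x', y', z', -, -, -, hspan', hJ'⟩ :=
      MohWindowShadeAnchorStep.exists_anchor_step π hπ hDπ hclπ hξ' hb h3 hR' _ _ hκκ' hrat'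
        (j := (0 : Fin 2)) (i := 1) (by decide) (fun l => by fin_cases l <;> simp) hxyz ⟨F, 0⟩ hdeg hI
    exact conclude _ x' y' z' (deletePthPowers_step_F c b ⟨F, 0⟩) hspan' hJ'
  · -- off the centre: transport
    have hoff : π.base ξ' ∉ (D : Set A.Z) := by rw [hDξ₀, Set.mem_singleton_iff]; exact hover
    obtain ⟨x', y', z', hspan', hJ'⟩ :=
      MohWindowShadeAnchorChart.exists_anchor_offCentre (E := E) π hπ hoff _ _ hκκ' hxyz ⟨F, 0⟩ hI
    exact conclude F x' y' z' hclean hspan' hJ'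

/-- **A run inside o1's regime of record whose initial stage has polynomial presentations stays inside the polynomial regime**
(algebraically closed field). [OURS · L1 W4.6 rung (iii)] NOT a statement of the manuscript. [folklore] -/
theorem permissibleRun_mohWindowSurfacePoly_of_start [IsAlgClosed K] (r : PermissibleRun p K)
    (hr : ∀ k, regimeMohWindowSurfaceInsep (p := p) (K := K) (r.A k) (r.E k))
    (h0 : Regime.mohWindowSurfacePoly (p := p) (K := K) (r.A 0) (r.E 0)) (k : ℕ) :
    Regime.mohWindowSurfacePoly (p := p) (K := K) (r.A k) (r.E k) := by
  induction k with
  | zero => exact h0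
  | succ k ih =>
    have h := mohWindowSurfacePoly_transform (r.π k) (r.blowup k) (r.hom_eq k) (r.permissible k) ih
      (by rw [← r.E_succ k]; exact hr (k + 1))
    rw [r.E_succ k]
    exact h

end MohWindowShadePolyPersistence

end CampaignW46

end Summit.ResolutionOfSingularities.ResolutionOfSingularities.Theorems

end
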